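/-
COR-CM (cell pub-hodgecm2, stage 2 of the Hodge ladder) — count-neutral KERNEL COMBINATORICS «order 16: the quaternion doublings `Q₈ × ℤ/2` and
`Q₈ ∘ ℤ/4` (Pauli)», part IX: the INSTANCES — both data are inhabited on Mathlibʼs `QuaternionGroup 2 ⋊ Multiplicative (ℤ/2)` (seat
prover-pub-hodgecm2-b23-g54-0, binder prover b23, gen 54; claim HOME/INBOX.md l.25095).  Bookkeeping definitions (`twistAut`, the type abbreviation
`DoublingType`, its `Fintype`/`DecidableEq` instances, `doublingDatum`) + theorems, on parts II–VIII and seat b23 gen 49ʼs `IndexTwoCyclic.homOfInvolutive`;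
`decide` only on closed identities in `QuaternionGroup 2` and `ZMod 2`/`ZMod 4`, no certificate, no named fact, no `sorry`.  `Interfaces.lean` (C1), every
E term, B01, `Transposition/*`, `PortJoin/*`, `D2Bridge/*` untouched.
HONEST FRAMING: `HC_CM` is NOT proved, here or anywhere in the tree; nothing here is a period, a count of record or a headline.
T5: THIS FILE IS THE INHABITATION of `QuaternionDoubling.Datum G c τ` for both `τ` (`nonempty_datum`); checker: self, 2026-08-26.
-/
import Summits.HodgeConjecture.CorCM.Census.QuaternionDoublingLaw
import Summits.HodgeConjecture.CorCM.Census.IndexTwoCyclicInstance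

/-!
# The quaternion doublings, IX: the instances `Q₈ ⋊_t (ℤ/2)`

`DoublingType t := QuaternionGroup 2 ⋊[twist t] Multiplicative (ℤ/2)`, the generator acting trivially (`t = 0`: `Q₈ × ℤ/2`) or by conjugation with
`k = xa 3` (`t = 1`: the Pauli group `Q₈ ∘ ℤ/4`).  `doublingDatum t` is a `QuaternionDoubling.Datum (DoublingType t) (inl (a 2)) t` with `i = inl (a 1)`,
`j = inl (xa 0)`, `x = inr 1` — so both data of part II are consistent (T5 inhabitation), and parts VIII give the ROWS on these concrete groups:
`μ = φ₂ = 18 = β` (`t = 0`) and `μ = φ₂ = 20 = β − 2` (`t = 1`).  All [folklore].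

## References
* [Pohlmann1968] H. Pohlmann, Algebraic cycles on abelian varieties of complex multiplication type, Ann. of Math. 88 (1968), Thm 1.
-/

namespace Summit.HodgeConjecture.CorCM.Census.QuaternionDoubling

open QuaternionGroup
open Summit.HodgeConjecture.CorCM.Prior.AllgGroup.RfwfAllgGroup
open Summit.HodgeConjecture.CorCM.Census.BlockParity
open Summit.HodgeConjecture.CorCM.Census.Coinvariant
open Summit.HodgeConjecture.CorCM.Census.IndexTwoCyclic (homOfInvolutive homOfInvolutive_ofAdd_one)

/-! ## §1 The groups -/

/-- **The twist automorphism** of `Q₈`: trivial (`t = 0`) or conjugation by `k = xa 3` (`t = 1`). [folklore] -/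
def twistAut (t : ZMod 2) : MulAut (QuaternionGroup 2) := if t = 0 then 1 else MulAut.conj (xa 3)

/-- Conjugation by `a 2 = −1` is trivial on `Q₈` (`−1` is central). [folklore] -/
theorem conj_a_two : MulAut.conj (a 2 : QuaternionGroup 2) = 1 := by
  ext g
  rw [MulAut.conj_apply, MulAut.one_apply]
  revert g
  decide

/-- The twist automorphism is an involution. [folklore] -/
theorem twistAut_mul_self (t : ZMod 2) : twistAut t * twistAut t = 1 := by
  unfold twistAut
  split_ifs
  · rw [one_mul]
  · rw [← map_mul, show (xa 3 : QuaternionGroup 2) * xa 3 = a 2 by decide, conj_a_two]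

/-- The trivial twist. [folklore] -/
theorem twistAut_zero_apply (n : QuaternionGroup 2) : twistAut 0 n = n := by simp [twistAut]

/-- The Pauli twist is conjugation by `xa 3`. [folklore] -/
theorem twistAut_one_apply (n : QuaternionGroup 2) : twistAut 1 n = xa 3 * n * (xa 3)⁻¹ := by
  simp [twistAut, show (1 : ZMod 2) ≠ 0 by decide]

/-- `c⁰ = 1`. [folklore] -/
theorem cpow_zero {K : Type*} [Group K] (k : K) : cpow k 0 = 1 := if_pos rfl

/-- `c¹ = c`. [folklore] -/
theorem cpow_one {K : Type*} [Group K] (k : K) : cpow k 1 = k := if_neg (by decide)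

/-- **THE GROUP `Q₈ ⋊_t ℤ/2`**: `Q₈ × ℤ/2` (`t = 0`) or the Pauli group `Q₈ ∘ ℤ/4` (`t = 1`). [folklore] -/
abbrev DoublingType (t : ZMod 2) : Type :=
  QuaternionGroup 2 ⋊[homOfInvolutive (twistAut t) (twistAut_mul_self t)] Multiplicative (ZMod 2)

variable (t : ZMod 2)

/-- `Q₈ ⋊_t ℤ/2` is finite. [folklore] -/
noncomputable instance instFintypeDoublingType : Fintype (DoublingType t) := Fintype.ofEquiv _ SemidirectProduct.equivProd.symm

/-- `Q₈ ⋊_t ℤ/2` has decidable equality. [folklore] -/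
instance instDecidableEqDoublingType : DecidableEq (DoublingType t) := SemidirectProduct.equivProd.decidableEq

/-- `|Q₈ ⋊_t ℤ/2| = 16`. [folklore] -/
theorem card_doublingType : Nat.card (DoublingType t) = 16 := by
  rw [SemidirectProduct.card, Nat.card_eq_fintype_card, Nat.card_eq_fintype_card, QuaternionGroup.card, Fintype.card_multiplicative, ZMod.card]

/-! ## §2 The datum -/

/-- The conjugate `x n x` in the semidirect product is `inl` of the twist (`x = inr 1` has order `2`). [folklore] -/
theorem inr_mul_inl_mul_inr (n : QuaternionGroup 2) :
    (SemidirectProduct.inr (Multiplicative.ofAdd (1 : ZMod 2)) : DoublingType t) * SemidirectProduct.inl n *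
      SemidirectProduct.inr (Multiplicative.ofAdd (1 : ZMod 2)) = SemidirectProduct.inl (twistAut t n) := by
  have hinv : (Multiplicative.ofAdd (1 : ZMod 2))⁻¹ = Multiplicative.ofAdd (1 : ZMod 2) := by decide
  rw [show twistAut t n = (homOfInvolutive (twistAut t) (twistAut_mul_self t) (Multiplicative.ofAdd (1 : ZMod 2))) n by
    rw [homOfInvolutive_ofAdd_one], SemidirectProduct.inl_aut, hinv]

/-- `ℤ/2` has two elements. [folklore] -/
private theorem zmod2_cases' : ∀ z : ZMod 2, z = 0 ∨ z = 1 := by decide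

/-- **THE DATUM on `Q₈ ⋊_t ℤ/2`**: `i = inl (a 1)`, `j = inl (xa 0)`, `x = inr 1`, `c = inl (a 2)`. [folklore] -/
noncomputable def doublingDatum : Datum (DoublingType t) (SemidirectProduct.inl (a 2)) t where
  i := SemidirectProduct.inl (a 1)
  j := SemidirectProduct.inl (xa 0)
  x := SemidirectProduct.inr (Multiplicative.ofAdd 1)
  hord_i := by
    rw [orderOf_injective SemidirectProduct.inl SemidirectProduct.inl_injective, QuaternionGroup.orderOf_a_one]
  hii := by rw [← map_mul]; exact congrArg _ (by decide)
  hjj := by rw [← map_mul]; exact congrArg _ (by decide)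
  hji := by rw [← map_mul, ← map_inv, ← map_mul, ← map_inv]; exact congrArg _ (by decide)
  hj := by
    intro h
    rw [mem_zpowers_iff_mem_range_orderOf, orderOf_injective SemidirectProduct.inl SemidirectProduct.inl_injective,
      QuaternionGroup.orderOf_a_one, Finset.mem_image] at h
    obtain ⟨k, hk, hke⟩ := h
    rw [← map_pow] at hke
    have hq := SemidirectProduct.inl_injective hke
    simp only [Finset.mem_range] at hk
    interval_cases k <;> exact absurd hq (by decide)
  hxx := by rw [← map_mul]; exact congrArg _ (by decide)
  hxi := by
    rw [inr_mul_inl_mul_inr]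
    rcases zmod2_cases' t with rfl | rfl
    · rw [twistAut_zero_apply, cpow_zero, one_mul]
    · rw [twistAut_one_apply, cpow_one, ← map_mul]
      exact congrArg _ (by decide)
  hxj := by
    rw [inr_mul_inl_mul_inr]
    rcases zmod2_cases' t with rfl | rfl
    · rw [twistAut_zero_apply, cpow_zero, one_mul]
    · rw [twistAut_one_apply, cpow_one, ← map_mul]
      exact congrArg _ (by decide)
  hx := by
    intro u v h
    have h2 := congrArg SemidirectProduct.rightHom h
    rw [SemidirectProduct.rightHom_inr, map_mul, map_pow, map_pow, SemidirectProduct.rightHom_inl, SemidirectProduct.rightHom_inl,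
      one_pow, one_pow, one_mul] at h2
    have h3 : (1 : ZMod 2) = 0 := congrArg Multiplicative.toAdd h2
    exact absurd h3 (by decide)
  hcard := card_doublingType t

/-- **T5 INHABITATION: the quaternion doubling datum is consistent for both twists.** [folklore] -/
theorem nonempty_datum : Nonempty (Datum (DoublingType t) (SemidirectProduct.inl (a 2)) t) := ⟨doublingDatum t⟩

/-! ## §3 The rows on the concrete groups -/

/-- `c·c = 1` on `Q₈ ⋊_t ℤ/2`. [folklore] -/
theorem doublingC_mul_self : (SemidirectProduct.inl (a 2) : DoublingType t) * SemidirectProduct.inl (a 2) = 1 := (doublingDatum t).c_mul_c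

/-- **THE LAW ON `Q₈ ⋊_t ℤ/2`**: `μ = φ₂` for both twists. [folklore] -/
theorem isLeast_card_gfaces_generate_fibreTwo_doublingType :
    IsLeast {m : ℕ | ∃ S : Finset (CMF (DoublingType t) (SemidirectProduct.inl (a 2)) →₀ ℤ),
      ↑S ⊆ gfaceSet (DoublingType t) (SemidirectProduct.inl (a 2)) (doublingC_mul_self t) ∧ S.card = m ∧
      hodgeSpan (SemidirectProduct.inl (a 2) : DoublingType t) (doublingC_mul_self t) ≤
        Submodule.span ℤ (pairSet (SemidirectProduct.inl (a 2) : DoublingType t)) ⊔ Submodule.span ℤ (translates (SemidirectProduct.inl (a 2)) S)}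
      (fibreTwo (SemidirectProduct.inl (a 2) : DoublingType t) (doublingC_mul_self t)) :=
  (doublingDatum t).isLeast_card_gfaces_generate_fibreTwo

/-- **THE ROW `Q₈ × ℤ/2`, `c = (−1, 0)`: `μ = φ₂ = 18 = β`.** [folklore] -/
theorem row_zero : fibreTwo (SemidirectProduct.inl (a 2) : DoublingType 0) (doublingC_mul_self 0) = 18 ∧
    Fintype.card (Block (SemidirectProduct.inl (a 2) : DoublingType 0)) = 18 :=
  ⟨(doublingDatum 0).isLeast_card_gfaces_generate_fibreTwo_zero.2.1, (doublingDatum 0).isLeast_card_gfaces_generate_fibreTwo_zero.2.2.1⟩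

/-- **THE ROW PAULI, `c = z²`: `μ = φ₂ = 20`, `β = 22`.** [folklore] -/
theorem row_one : fibreTwo (SemidirectProduct.inl (a 2) : DoublingType 1) (doublingC_mul_self 1) = 20 ∧
    Fintype.card (Block (SemidirectProduct.inl (a 2) : DoublingType 1)) = 22 :=
  ⟨(doublingDatum 1).isLeast_card_gfaces_generate_fibreTwo_one.2.1, (doublingDatum 1).isLeast_card_gfaces_generate_fibreTwo_one.2.2.1⟩

end Summit.HodgeConjecture.CorCM.Census.QuaternionDoubling
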